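import Summits.QuantumFields.YangMills.Theorems.QuantileBitPurityFluxGood
import Summits.QuantumFields.YangMills.Theorems.QuantileBitPurityFluxNumerics
import Summits.QuantumFields.YangMills.Theorems.ToronSmallBallOwnAxisShiftWindowGen
import Summits.QuantumFields.YangMills.Theorems.QuantileBitPuritySectorPerm
import HarnessLib

/-!
# Electric-flux sector suppression on the window: every twisted seam sector is `O(β^(−a/2))` of the zero-flux trace

Support module (`--supports` stmt-QuantumFields-24093, `QuantileBitPurity.EquatorBandVanishing`, and the engine of ⟨24079⟩
`FluxSectorLaplace.FluxSectorSuppression`; seat ym-dw-p1 g17, LINE g12-B of ideator seat ym-idea-4).  Assembles the flux-reflection lever: for an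
`x`-twisted sector `z` (`z 0 = true`) the reflection bound (`QuantileBitPurityFluxGood`) controls `W_z(1)` by the PERIODIC weight of the thin equator band
`{|Re tr P_x(U₀)| ≤ 8L²η}` plus bad fields; the band lies in the own-axis strip `{|polDist − 2| ≤ 8L²η, 1 < polDist}` (`polDist² = 4 − 2|Re tr P_x|`), which
the tree's strip estimate `OwnAxis.sectorWeight_stripGen_le_rpow_of_numerics` (at the equator: `c₀ = 1`, floor `σ = 1/4`, `η = β^(−19/40)`, `K = ⌈64eβ^a⌉₊`
translates; numerics `numericsThin_of_le`) bounds by `β^(−a)·Z_phys`.  Results, for `0 < a ≤ 1/400`, `β ≥ β₀(a)`, `1 ≤ L ≤ β^a`, ring length `n+1 ≤ 2L`: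

★ `sectorWeight_twisted_le_rpow_odd` / `…_even`: `W_z(1) ≤ 13 β^(−a/2) · Z_phys(n+1)` for `z 0 = true`;
★ `sectorWeight_ne_zero_le_rpow_even`: the same for EVERY `z ≠ 0` on even rings (axis permutation, `QuantileBitPuritySectorPerm`).

HONEST FRAMING: fixed-lattice transfer-matrix inequalities on the window `L ≤ β^a`; electric-flux suppression WITHOUT semiclassics; nothing about infinite
volume, the continuum limit or the Clay gap; the YM mass gap is NOT proved.  No `sorry`, no new axiom, no new definition.
References: [cite: tHooft1979]; [cite: Luscher1983, §2]; E. T. Tomboulis, L. G. Yaffe, CMP 100 (1985) 313.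
-/

set_option autoImplicit false

noncomputable section

open MeasureTheory Filter Topology Real Function Set
open scoped BigOperators
open Literature.MathematicalPhysics.QuantumLattice
open Literature.MathematicalPhysics.QuantumFieldTheory hiding SU2
open Summit.QuantumFields.YangMills.Theorems

namespace Summit.QuantumFields.YangMills.Theorems.FemtoTransferGap.Flux

open Summit.QuantumFields.YangMills.Theorems.FemtoTransferGap
open Summit.QuantumFields.YangMills.Theorems.FemtoTransferGap.FlatSheet
open Summit.QuantumFields.YangMills.Theorems.FemtoTransferGap.TT
open Summit.QuantumFields.YangMills.Theorems.FemtoTransferGap.OwnAxis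

variable {L : ℕ} [NeZero L]

/-! ## §1 The thin trace band sits in the own-axis strip at the equator -/

omit [NeZero L] in
/-- `{|Re tr P_x| ≤ τ} ⊆ {|polDist − 2| ≤ w, 1 < polDist}` for `0 ≤ τ ≤ w`, `τ ≤ 1/2` (`polDist² = 4 − 2|Re tr P_x|`). [cite: Luscher1983, §2] -/
theorem traceBand_indicator_le_strip {τ w : ℝ} (hτ0 : 0 ≤ τ) (hτw : τ ≤ w) (hτ1 : τ ≤ 1 / 2) (U : GaugeConfig 3 L SU2) :
    {U : GaugeConfig 3 L SU2 | |((polyX U : SU2) : Matrix (Fin 2) (Fin 2) ℂ).trace.re| ≤ τ}.indicator (fun _ => (1 : ℝ)) U ≤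
      {U : GaugeConfig 3 L SU2 | |polDist U - (fun _ : GaugeConfig 3 L SU2 => (2 : ℝ)) U| ≤ w ∧ 1 < polDist U}.indicator (fun _ => (1 : ℝ)) U := by
  by_cases h : U ∈ {U : GaugeConfig 3 L SU2 | |((polyX U : SU2) : Matrix (Fin 2) (Fin 2) ℂ).trace.re| ≤ τ}
  · have hτ : |((polyX U : SU2) : Matrix (Fin 2) (Fin 2) ℂ).trace.re| ≤ τ := h
    have hsq := polDist_sq_eq U
    have hp0 := polDist_nonneg U
    have hp2 := polDist_le_two U
    have hlow : 2 - τ ≤ polDist U := by nlinarith [abs_nonneg (((polyX U : SU2) : Matrix (Fin 2) (Fin 2) ℂ).trace.re)]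
    have hmem : U ∈ {U : GaugeConfig 3 L SU2 | |polDist U - (fun _ : GaugeConfig 3 L SU2 => (2 : ℝ)) U| ≤ w ∧ 1 < polDist U} := by
      refine ⟨?_, by linarith⟩
      show |polDist U - 2| ≤ w
      rw [abs_le]; constructor <;> linarith
    rw [Set.indicator_of_mem h, Set.indicator_of_mem hmem]
  · rw [Set.indicator_of_notMem h]; exact Set.indicator_nonneg (fun _ _ => zero_le_one) _

omit [NeZero L] in
/-- Monotonicity of trace bands. [folklore] -/
theorem traceBand_indicator_mono {τ τ' : ℝ} (h : τ ≤ τ') (U : GaugeConfig 3 L SU2) :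
    {U : GaugeConfig 3 L SU2 | |((polyX U : SU2) : Matrix (Fin 2) (Fin 2) ℂ).trace.re| ≤ τ}.indicator (fun _ => (1 : ℝ)) U ≤
      {U : GaugeConfig 3 L SU2 | |((polyX U : SU2) : Matrix (Fin 2) (Fin 2) ℂ).trace.re| ≤ τ'}.indicator (fun _ => (1 : ℝ)) U := by
  refine Set.indicator_le_indicator_of_subset (fun V hV => ?_) (fun _ => zero_le_one) U
  exact le_trans (show |((polyX V : SU2) : Matrix (Fin 2) (Fin 2) ℂ).trace.re| ≤ τ from hV) h

/-- √-bookkeeping: `3√A√X + X + Y ≤ 13 β^{−a/2} Z` when `A ≤ 8Z`, `X ≤ (3/2)β^{−a}Z`, `Y ≤ β^{−a}/2·Z`, `Z ≥ 0`, `β ≥ 1`. [folklore] -/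
theorem sqrt_bookkeeping {A X Y Z β a : ℝ} (hβ1 : 1 ≤ β) (ha : 0 ≤ a) (hZ : 0 ≤ Z) (hA0 : 0 ≤ A) (hX0 : 0 ≤ X) (hA : A ≤ 8 * Z)
    (hX : X ≤ 3 / 2 * β ^ (-a) * Z) (hY : Y ≤ β ^ (-a) / 2 * Z) :
    3 * Real.sqrt A * Real.sqrt X + X + Y ≤ 13 * β ^ (-(a / 2)) * Z := by
  have hβ0 : 0 < β := by linarith
  have hr0 : 0 ≤ β ^ (-(a / 2)) := Real.rpow_nonneg hβ0.le _
  have hsq : β ^ (-(a / 2)) * β ^ (-(a / 2)) = β ^ (-a) := by rw [← Real.rpow_add hβ0]; ring_nf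
  have hr1 : β ^ (-a) ≤ β ^ (-(a / 2)) := Real.rpow_le_rpow_of_exponent_le hβ1 (by linarith)
  have hAX : Real.sqrt A * Real.sqrt X ≤ Real.sqrt 12 * (β ^ (-(a / 2)) * Z) := by
    rw [← Real.sqrt_mul hA0, ← Real.sqrt_mul_self (by positivity : 0 ≤ β ^ (-(a / 2)) * Z), ← Real.sqrt_mul (by norm_num)]
    refine Real.sqrt_le_sqrt ?_
    calc A * X ≤ (8 * Z) * (3 / 2 * β ^ (-a) * Z) := mul_le_mul hA hX hX0 (by positivity)
      _ = 12 * (β ^ (-(a / 2)) * Z * (β ^ (-(a / 2)) * Z)) := by rw [← hsq]; ring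
  have h12 : Real.sqrt 12 ≤ 7 / 2 := by
    calc Real.sqrt 12 ≤ Real.sqrt ((7 / 2) ^ 2) := Real.sqrt_le_sqrt (by norm_num)
      _ = 7 / 2 := Real.sqrt_sq (by norm_num)
  have hXZ : X ≤ 3 / 2 * β ^ (-(a / 2)) * Z := hX.trans (by nlinarith)
  have hYZ : Y ≤ 1 / 2 * β ^ (-(a / 2)) * Z := hY.trans (by nlinarith)
  nlinarith [Real.sqrt_nonneg A, Real.sqrt_nonneg X, mul_nonneg hr0 hZ]

/-! ## §2 Twisted-sector suppression on the window -/

set_option maxHeartbeats 800000 in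
/-- ★ **Twisted-sector suppression, odd ring** (`n = 1 + (q + 1 + q)`, `n+1 ≤ 2L`): for `0 < a ≤ 1/400`, `β ≥ β₀(a)`, `1 ≤ L ≤ β^a` and every
`x`-twisted sector (`z 0 = true`), `W_z(1) ≤ 13 β^(−a/2) · Z_phys(n+1)`. [cite: tHooft1979] [cite: Luscher1983, §2] -/
theorem sectorWeight_twisted_le_rpow_odd {a : ℝ} (ha : 0 < a) (ha' : a ≤ 1 / 400) :
    ∃ β₀ : ℝ, ∀ β : ℝ, β₀ ≤ β → ∀ (L : ℕ) [NeZero L], (L : ℝ) ≤ β ^ a → ∀ q : ℕ, 1 + (q + 1 + q) + 1 ≤ 2 * L →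
      ∀ z : Fin 3 → Bool, z 0 = true →
        sectorWeight (L := L) β (1 + (q + 1 + q)) z (fun _ _ => (1 : ℝ)) ≤ 13 * β ^ (-(a / 2)) * physTraceSucc L β (1 + (q + 1 + q)) := by
  obtain ⟨β₀, hnum⟩ := numericsThin_of_le ha ha'
  refine ⟨β₀, fun β hβ L _ hLa q hn2 z hz => ?_⟩
  haveI : SecondCountableTopology SU2 := secondCountableTopology_su2
  have hL1 : 1 ≤ L := NeZero.one_le
  obtain ⟨h200, hη, h32, hK1, hβη, hmaster, hG, hKa⟩ := hnum β hβ L hL1 hLa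
  set η : ℝ := β ^ (-(1 / 2 - 1 / 40 : ℝ)) with hηdef
  have hβ1 : 1 ≤ β := by linarith
  have hβ0 : 0 < β := by linarith
  have hn1 : 1 ≤ 1 + (q + 1 + q) := by omega
  have hL1r : (1 : ℝ) ≤ L := by exact_mod_cast hL1
  have hLr : (0 : ℝ) ≤ L := Nat.cast_nonneg L
  obtain ⟨hfl, h8⟩ := floor_of_small (L := L) h32
  have hP0 : 0 ≤ ((⌈64 * Real.exp 1 * β ^ a⌉₊ : ℕ) : ℝ) * (6 * (8 * (L : ℝ) ^ 2 * η)) := by positivity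
  obtain ⟨hKσ, hJ, hQ⟩ := shift_jac_cost_of_master (β := β) (L := L) hP0 hβη hL1r hmaster
  have hw : 0 < 8 * (L : ℝ) ^ 2 * η := by positivity
  -- the periodic thin strip at the equator
  have hstrip := sectorWeight_stripGen_le_rpow_of_numerics (L := L) (z := fun _ => false) rfl (f := fun _ => (2 : ℝ)) measurable_const
    (fun _ _ => rfl) hn1 hn2 h200 hη hw (θ' := 6 * (8 * (L : ℝ) ^ 2 * η)) (by linarith) (σ := 1 / 4) (by norm_num) (by norm_num) (c₀ := 1)
    hfl hK1 hKσ hQ hJ hG hKa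
  -- the trace band inside the strip
  have hZ0 := physTraceSucc_nonneg_of (L := L) hn1 h200
  have hτ : 2 * (L : ℝ) * ((q + 3) * η) ≤ 8 * (L : ℝ) ^ 2 * η := by
    have hq : ((q : ℝ) + 3) ≤ 4 * L := by
      have : ((1 + (q + 1 + q) + 1 : ℕ) : ℝ) ≤ ((2 * L : ℕ) : ℝ) := by exact_mod_cast hn2
      push_cast at this; linarith
    nlinarith [hη.le]
  have mB : ∀ τ : ℝ, Measurable (uncurry fun (Us : Fin (1 + (q + 1 + q) + 1) → GaugeConfig 3 L SU2) (_g : Site 3 L → SU2) => {U : GaugeConfig 3 L SU2 | |((polyX U : SU2) : Matrix (Fin 2) (Fin 2) ℂ).trace.re| ≤ τ}.indicator (fun _ => (1 : ℝ)) (Us 0)) :=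
    fun τ => measurable_uncurry_slice_zero (measurable_const.indicator (measurableSet_reTraceBand (L := L) τ))
  have mS : Measurable (uncurry fun (Us : Fin (1 + (q + 1 + q) + 1) → GaugeConfig 3 L SU2) (_g : Site 3 L → SU2) =>
      {U : GaugeConfig 3 L SU2 | |polDist U - (fun _ : GaugeConfig 3 L SU2 => (2 : ℝ)) U| ≤ 8 * (L : ℝ) ^ 2 * η ∧ 1 < polDist U}.indicator (fun _ => (1 : ℝ)) (Us 0)) :=
    measurable_uncurry_slice_zero (measurable_const.indicator (measurableSet_stripGen measurable_const _ _))
  have hband : sectorWeight (L := L) β (1 + (q + 1 + q)) (fun _ => false) (fun Us _ => {U : GaugeConfig 3 L SU2 | |((polyX U : SU2) : Matrix (Fin 2) (Fin 2) ℂ).trace.re| ≤ (2 * L * ((q + 3) * η))}.indicator (fun _ => (1 : ℝ)) (Us 0)) ≤ β ^ (-a) * physTraceSucc L β (1 + (q + 1 + q)) := by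
    refine le_trans (sectorWeight_mono β _ _ (mB _) mS (fun Us _ => FluxReflection.abs_ind_le_one _ (Us 0)) (fun Us _ => FluxReflection.abs_ind_le_one _ (Us 0))
      (fun Us _ => (traceBand_indicator_mono hτ (Us 0)).trans (traceBand_indicator_le_strip (by positivity) le_rfl h8 (Us 0)))) hstrip
  -- bad fields in the untwisted and in the twisted sector
  have hbad : ∀ w : Fin 3 → Bool, sectorWeight (L := L) β (1 + (q + 1 + q)) w (fun Us g => (goodEvent (L := L) (1 + (q + 1 + q)) w (η ^ 2) η)ᶜ.indicator (fun _ => (1 : ℝ)) (g, Us)) ≤ β ^ (-a) / 2 * physTraceSucc L β (1 + (q + 1 + q)) :=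
    fun w => (sectorWeight_indicator_compl_goodEvent_le_floor (L := L) hn1 (by linarith) (floor_const_le.trans h200) w (η ^ 2) hη.le).trans
      (bad_numerics_mul_le (L := L) hn2 hβ1 hG hZ0)
  have hW1 := sectorWeight_one_le (L := L) β (1 + (q + 1 + q)) (fun _ => false)
  -- the reflection bound and the bookkeeping
  have key := sectorWeight_twisted_le_band_odd (L := L) hβ0.le hz q (η ^ 2) hη.le
  have hA0 : 0 ≤ sectorWeight (L := L) β (1 + (q + 1 + q)) (fun _ => false) (fun _ _ => (1 : ℝ)) := sectorWeight_nonneg β _ _ fun _ _ => zero_le_one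
  have hB0 : 0 ≤ sectorWeight (L := L) β (1 + (q + 1 + q)) (fun _ => false) (fun Us _ => {U : GaugeConfig 3 L SU2 | |((polyX U : SU2) : Matrix (Fin 2) (Fin 2) ℂ).trace.re| ≤ (2 * L * ((q + 3) * η))}.indicator (fun _ => (1 : ℝ)) (Us 0)) :=
    sectorWeight_nonneg β _ _ fun Us _ => FluxReflection.ind_nonneg _ _
  have hG0 : ∀ w : Fin 3 → Bool, 0 ≤ sectorWeight (L := L) β (1 + (q + 1 + q)) w (fun Us g => (goodEvent (L := L) (1 + (q + 1 + q)) w (η ^ 2) η)ᶜ.indicator (fun _ => (1 : ℝ)) (g, Us)) :=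
    fun w => sectorWeight_nonneg β _ _ fun Us g => FluxReflection.ind_nonneg _ _
  have hX : sectorWeight (L := L) β (1 + (q + 1 + q)) (fun _ => false) (fun Us _ => {U : GaugeConfig 3 L SU2 | |((polyX U : SU2) : Matrix (Fin 2) (Fin 2) ℂ).trace.re| ≤ (2 * L * ((q + 3) * η))}.indicator (fun _ => (1 : ℝ)) (Us 0)) +
      sectorWeight (L := L) β (1 + (q + 1 + q)) (fun _ => false) (fun Us g => (goodEvent (L := L) (1 + (q + 1 + q)) (fun _ => false) (η ^ 2) η)ᶜ.indicator (fun _ => (1 : ℝ)) (g, Us)) ≤ 3 / 2 * β ^ (-a) * physTraceSucc L β (1 + (q + 1 + q)) := by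
    linarith [hbad (fun _ => false)]
  have hG00 := hG0 (fun _ => false)
  have hfin := sqrt_bookkeeping hβ1 ha.le hZ0 hA0 (add_nonneg hB0 hG00) hW1 hX (hbad z)
  linarith

set_option maxHeartbeats 800000 in
/-- ★ **Twisted-sector suppression, even ring** (`n = 1 + (q + q)`, `n+1 ≤ 2L`): for `0 < a ≤ 1/400`, `β ≥ β₀(a)`, `1 ≤ L ≤ β^a` and every
`x`-twisted sector (`z 0 = true`), `W_z(1) ≤ 13 β^(−a/2) · Z_phys(n+1)`. [cite: tHooft1979] [cite: Luscher1983, §2] -/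
theorem sectorWeight_twisted_le_rpow_even {a : ℝ} (ha : 0 < a) (ha' : a ≤ 1 / 400) :
    ∃ β₀ : ℝ, ∀ β : ℝ, β₀ ≤ β → ∀ (L : ℕ) [NeZero L], (L : ℝ) ≤ β ^ a → ∀ q : ℕ, 1 + (q + q) + 1 ≤ 2 * L →
      ∀ z : Fin 3 → Bool, z 0 = true →
        sectorWeight (L := L) β (1 + (q + q)) z (fun _ _ => (1 : ℝ)) ≤ 13 * β ^ (-(a / 2)) * physTraceSucc L β (1 + (q + q)) := by
  obtain ⟨β₀, hnum⟩ := numericsThin_of_le ha ha'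
  refine ⟨β₀, fun β hβ L _ hLa q hn2 z hz => ?_⟩
  haveI : SecondCountableTopology SU2 := secondCountableTopology_su2
  have hL1 : 1 ≤ L := NeZero.one_le
  obtain ⟨h200, hη, h32, hK1, hβη, hmaster, hG, hKa⟩ := hnum β hβ L hL1 hLa
  set η : ℝ := β ^ (-(1 / 2 - 1 / 40 : ℝ)) with hηdef
  have hβ1 : 1 ≤ β := by linarith
  have hβ0 : 0 < β := by linarith
  have hn1 : 1 ≤ 1 + (q + q) := by omega
  have hL1r : (1 : ℝ) ≤ L := by exact_mod_cast hL1
  have hLr : (0 : ℝ) ≤ L := Nat.cast_nonneg L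
  obtain ⟨hfl, h8⟩ := floor_of_small (L := L) h32
  have hP0 : 0 ≤ ((⌈64 * Real.exp 1 * β ^ a⌉₊ : ℕ) : ℝ) * (6 * (8 * (L : ℝ) ^ 2 * η)) := by positivity
  obtain ⟨hKσ, hJ, hQ⟩ := shift_jac_cost_of_master (β := β) (L := L) hP0 hβη hL1r hmaster
  have hw : 0 < 8 * (L : ℝ) ^ 2 * η := by positivity
  -- the periodic thin strip at the equator
  have hstrip := sectorWeight_stripGen_le_rpow_of_numerics (L := L) (z := fun _ => false) rfl (f := fun _ => (2 : ℝ)) measurable_const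
    (fun _ _ => rfl) hn1 hn2 h200 hη hw (θ' := 6 * (8 * (L : ℝ) ^ 2 * η)) (by linarith) (σ := 1 / 4) (by norm_num) (by norm_num) (c₀ := 1)
    hfl hK1 hKσ hQ hJ hG hKa
  -- the trace band inside the strip
  have hZ0 := physTraceSucc_nonneg_of (L := L) hn1 h200
  have hτ : 2 * (L : ℝ) * ((q + 3) * η) ≤ 8 * (L : ℝ) ^ 2 * η := by
    have hq : ((q : ℝ) + 3) ≤ 4 * L := by
      have : ((1 + (q + q) + 1 : ℕ) : ℝ) ≤ ((2 * L : ℕ) : ℝ) := by exact_mod_cast hn2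
      push_cast at this; linarith
    nlinarith [hη.le]
  have mB : ∀ τ : ℝ, Measurable (uncurry fun (Us : Fin (1 + (q + q) + 1) → GaugeConfig 3 L SU2) (_g : Site 3 L → SU2) => {U : GaugeConfig 3 L SU2 | |((polyX U : SU2) : Matrix (Fin 2) (Fin 2) ℂ).trace.re| ≤ τ}.indicator (fun _ => (1 : ℝ)) (Us 0)) :=
    fun τ => measurable_uncurry_slice_zero (measurable_const.indicator (measurableSet_reTraceBand (L := L) τ))
  have mS : Measurable (uncurry fun (Us : Fin (1 + (q + q) + 1) → GaugeConfig 3 L SU2) (_g : Site 3 L → SU2) =>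
      {U : GaugeConfig 3 L SU2 | |polDist U - (fun _ : GaugeConfig 3 L SU2 => (2 : ℝ)) U| ≤ 8 * (L : ℝ) ^ 2 * η ∧ 1 < polDist U}.indicator (fun _ => (1 : ℝ)) (Us 0)) :=
    measurable_uncurry_slice_zero (measurable_const.indicator (measurableSet_stripGen measurable_const _ _))
  have hband : sectorWeight (L := L) β (1 + (q + q)) (fun _ => false) (fun Us _ => {U : GaugeConfig 3 L SU2 | |((polyX U : SU2) : Matrix (Fin 2) (Fin 2) ℂ).trace.re| ≤ (2 * L * ((q + 3) * η))}.indicator (fun _ => (1 : ℝ)) (Us 0)) ≤ β ^ (-a) * physTraceSucc L β (1 + (q + q)) := by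
    refine le_trans (sectorWeight_mono β _ _ (mB _) mS (fun Us _ => FluxReflection.abs_ind_le_one _ (Us 0)) (fun Us _ => FluxReflection.abs_ind_le_one _ (Us 0))
      (fun Us _ => (traceBand_indicator_mono hτ (Us 0)).trans (traceBand_indicator_le_strip (by positivity) le_rfl h8 (Us 0)))) hstrip
  -- bad fields in the untwisted and in the twisted sector
  have hbad : ∀ w : Fin 3 → Bool, sectorWeight (L := L) β (1 + (q + q)) w (fun Us g => (goodEvent (L := L) (1 + (q + q)) w (η ^ 2) η)ᶜ.indicator (fun _ => (1 : ℝ)) (g, Us)) ≤ β ^ (-a) / 2 * physTraceSucc L β (1 + (q + q)) :=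
    fun w => (sectorWeight_indicator_compl_goodEvent_le_floor (L := L) hn1 (by linarith) (floor_const_le.trans h200) w (η ^ 2) hη.le).trans
      (bad_numerics_mul_le (L := L) hn2 hβ1 hG hZ0)
  have hW1 := sectorWeight_one_le (L := L) β (1 + (q + q)) (fun _ => false)
  -- the reflection bound and the bookkeeping
  have key := sectorWeight_twisted_le_band_even (L := L) β hz q (η ^ 2) hη.le
  have hA0 : 0 ≤ sectorWeight (L := L) β (1 + (q + q)) (fun _ => false) (fun _ _ => (1 : ℝ)) := sectorWeight_nonneg β _ _ fun _ _ => zero_le_one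
  have hB0 : 0 ≤ sectorWeight (L := L) β (1 + (q + q)) (fun _ => false) (fun Us _ => {U : GaugeConfig 3 L SU2 | |((polyX U : SU2) : Matrix (Fin 2) (Fin 2) ℂ).trace.re| ≤ (2 * L * ((q + 3) * η))}.indicator (fun _ => (1 : ℝ)) (Us 0)) :=
    sectorWeight_nonneg β _ _ fun Us _ => FluxReflection.ind_nonneg _ _
  have hG0 : ∀ w : Fin 3 → Bool, 0 ≤ sectorWeight (L := L) β (1 + (q + q)) w (fun Us g => (goodEvent (L := L) (1 + (q + q)) w (η ^ 2) η)ᶜ.indicator (fun _ => (1 : ℝ)) (g, Us)) :=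
    fun w => sectorWeight_nonneg β _ _ fun Us g => FluxReflection.ind_nonneg _ _
  have hX : sectorWeight (L := L) β (1 + (q + q)) (fun _ => false) (fun Us _ => {U : GaugeConfig 3 L SU2 | |((polyX U : SU2) : Matrix (Fin 2) (Fin 2) ℂ).trace.re| ≤ (2 * L * ((q + 3) * η))}.indicator (fun _ => (1 : ℝ)) (Us 0)) +
      sectorWeight (L := L) β (1 + (q + q)) (fun _ => false) (fun Us g => (goodEvent (L := L) (1 + (q + q)) (fun _ => false) (η ^ 2) η)ᶜ.indicator (fun _ => (1 : ℝ)) (g, Us)) ≤ 3 / 2 * β ^ (-a) * physTraceSucc L β (1 + (q + q)) := by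
    linarith [hbad (fun _ => false)]
  have hG00 := hG0 (fun _ => false)
  have hfin := sqrt_bookkeeping hβ1 ha.le hZ0 hA0 (add_nonneg hB0 hG00) hW1 hX ((le_trans (le_refl (0:ℝ)) (by positivity) : (0:ℝ) ≤ β ^ (-a) / 2 * physTraceSucc L β (1 + (q + q))))
  linarith

/-! ## §3 Every twisted sector (axis permutations) -/

/-- A non-zero twist vector without `x`-component is `e₁`, `e₂` or `e₁ + e₂`. [folklore] -/
theorem twist_cases_of_apply_zero {z : Fin 3 → Bool} (hz0 : z 0 = false) (hz : z ≠ fun _ => false) :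
    z = (fun j : Fin 3 => decide (j = 1)) ∨ z = (fun j : Fin 3 => decide (j = 2)) ∨ z = (fun j : Fin 3 => !decide (j = 0)) := by
  rcases Bool.eq_false_or_eq_true (z 1) with h1 | h1 <;> rcases Bool.eq_false_or_eq_true (z 2) with h2 | h2
  · right; right; funext j; fin_cases j <;> simp [hz0, h1, h2]
  · left; funext j; fin_cases j <;> simp [hz0, h1, h2]
  · right; left; funext j; fin_cases j <;> simp [hz0, h1, h2]
  · exfalso; apply hz; funext j; fin_cases j <;> simp [hz0, h1, h2]

/-- ★ **Every twisted sector is suppressed on even rings**: for `0 < a ≤ 1/400`, `β ≥ β₀(a)`, `1 ≤ L ≤ β^a`, `n = 1 + (q+q)`, `n+1 ≤ 2L` and every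
`z ≠ 0`, `W_z(1) ≤ 13 β^(−a/2) · Z_phys(n+1)` (the `x`-twisted case by flux reflection, the others by the axis permutations of
`QuantileBitPuritySectorPerm`). [cite: tHooft1979] [cite: Luscher1983, §2] -/
theorem sectorWeight_ne_zero_le_rpow_even {a : ℝ} (ha : 0 < a) (ha' : a ≤ 1 / 400) :
    ∃ β₀ : ℝ, ∀ β : ℝ, β₀ ≤ β → ∀ (L : ℕ) [NeZero L], (L : ℝ) ≤ β ^ a → ∀ q : ℕ, 1 + (q + q) + 1 ≤ 2 * L →
      ∀ z : Fin 3 → Bool, z ≠ (fun _ => false) →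
        sectorWeight (L := L) β (1 + (q + q)) z (fun _ _ => (1 : ℝ)) ≤ 13 * β ^ (-(a / 2)) * physTraceSucc L β (1 + (q + q)) := by
  obtain ⟨β₀, h⟩ := sectorWeight_twisted_le_rpow_even (a := a) ha ha'
  refine ⟨β₀, fun β hβ L _ hLa q hn2 z hz => ?_⟩
  by_cases hz0 : z 0 = true
  · exact h β hβ L hLa q hn2 z hz0
  · rw [Bool.not_eq_true] at hz0
    rcases twist_cases_of_apply_zero hz0 hz with hz1 | hz2 | hz3
    · rw [hz1, sectorWeight_one_eq_of_single β _ 1 0]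
      exact h β hβ L hLa q hn2 _ (by simp)
    · rw [hz2, sectorWeight_one_eq_of_single β _ 2 0]
      exact h β hβ L hLa q hn2 _ (by simp)
    · rw [hz3, sectorWeight_one_eq_of_double β _ 0 1]
      exact h β hβ L hLa q hn2 _ (by simp)

/-- ★ **Every twisted sector is suppressed on odd rings** (`n = 1 + (q+1+q)`). [cite: tHooft1979] [cite: Luscher1983, §2] -/
theorem sectorWeight_ne_zero_le_rpow_odd {a : ℝ} (ha : 0 < a) (ha' : a ≤ 1 / 400) :
    ∃ β₀ : ℝ, ∀ β : ℝ, β₀ ≤ β → ∀ (L : ℕ) [NeZero L], (L : ℝ) ≤ β ^ a → ∀ q : ℕ, 1 + (q + 1 + q) + 1 ≤ 2 * L →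
      ∀ z : Fin 3 → Bool, z ≠ (fun _ => false) →
        sectorWeight (L := L) β (1 + (q + 1 + q)) z (fun _ _ => (1 : ℝ)) ≤ 13 * β ^ (-(a / 2)) * physTraceSucc L β (1 + (q + 1 + q)) := by
  obtain ⟨β₀, h⟩ := sectorWeight_twisted_le_rpow_odd (a := a) ha ha'
  refine ⟨β₀, fun β hβ L _ hLa q hn2 z hz => ?_⟩
  by_cases hz0 : z 0 = true
  · exact h β hβ L hLa q hn2 z hz0
  · rw [Bool.not_eq_true] at hz0
    rcases twist_cases_of_apply_zero hz0 hz with hz1 | hz2 | hz3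
    · rw [hz1, sectorWeight_one_eq_of_single β _ 1 0]
      exact h β hβ L hLa q hn2 _ (by simp)
    · rw [hz2, sectorWeight_one_eq_of_single β _ 2 0]
      exact h β hβ L hLa q hn2 _ (by simp)
    · rw [hz3, sectorWeight_one_eq_of_double β _ 0 1]
      exact h β hβ L hLa q hn2 _ (by simp)

end Summit.QuantumFields.YangMills.Theorems.FemtoTransferGap.Flux

end
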